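import Mathlib
import HarnessLib
import Literature.Analysis.FluidPDE.TaoEnstrophyLocalisation
import Summits.NavierStokesRegularity.NavierStokesRegularity.Theorems.AxisTwistDoorAveragedConeLiouvilleCircleStokes

/-!
# Route `AxisTwistDoor`, crux `AveragedConeLiouville` (stmt-NavierStokesRegularity-26889) — calculus of the cylindrical
# frame of the line `lrt_shell` (helper for the stub `stub_circleToolkit`, file `…CircleToolkit.lean`)

Pointwise facts about the vocabulary of `Theorems/AxisTwistDoorAveragedConeLiouvilleDefs.lean`: the frame
`e_r(θ) = (cos θ, sin θ, 0)`, `e_θ(θ) = (−sin θ, cos θ, 0)`, `e₃` (unit norms, components, `|⟪w,e_r⟫| ≤ |w_h|`), the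
circle parametrisation `cylPt r θ z = (r cos θ, r sin θ, z)` (smooth in all variables; `∂_z cylPt = e₃`; the
`θ`-derivative, periodicity and continuity of the frame are REUSED from `…AveragedConeLiouvilleCircleStokes.lean`), the chain rules along the vertical line and along the circle for a differentiable slice, the
POINTWISE VORTICITY IDENTITY `ω_r r = ∂_θ v₃ − r ⟪Dv e₃, e_θ⟫` behind `∂_zΓ = −∮ω_r dl` (`inner_curl_eR_mul`, pure
linear algebra on the tree's `curl`), `∮ ∂_θ v₃ dθ = 0`, and the two pieces of real-variable bookkeeping behind the
one-sided shell inequality of Lei–Ren–Tian arXiv:2501.08976 (display before eq. Gamma-34):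
`|(v_r ω₃ − ω_r v₃) r| ≤ B(ω₃ + |ω_h|) r` under `|v| ≤ B`, `ω₃ ≥ 0`, and `|∫f| ≤ B(∫g₁ + ∫g₂)` from `|f| ≤ B(g₁+g₂)`.

Seat ns-atd-p1 (LEAD of route AxisTwistDoor). WHAT THIS IS NOT: not a statement about Navier–Stokes regularity —
elementary calculus for a STAGED door route; nothing about the crux is claimed here. Lands `--supports` the crux item
as a helper.
-/

noncomputable section

-- the summit and its single sub-problem share the name (CONVENTIONS §1), as in every Theorems file
set_option linter.dupNamespace false

namespace Summit.NavierStokesRegularity.NavierStokesRegularity.Theorems.AxisTwistDoorAveragedConeLiouvilleCylFrame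

open scoped BigOperators Topology InnerProductSpace ContDiff
open Filter Set Function MeasureTheory Metric intervalIntegral
open Literature.Analysis
open Literature.Analysis.FluidPDE hiding eR
open Summit.NavierStokesRegularity.NavierStokesRegularity.Theorems.AxisTwistDoorAveragedConeLiouvilleDefs
open Summit.NavierStokesRegularity.NavierStokesRegularity.Theorems.AveragedConeLiouville.CircleStokes
  (inner_e3 cylPt_two_pi continuous_eR continuous_eT hasDerivAt_cylPt_theta)

/-! ### Pointwise facts about the cylindrical frame -/

/-- `⟪w, e_r(θ)⟫ = w₀ cos θ + w₁ sin θ`. -/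
theorem inner_eR (w : EuclideanSpace ℝ (Fin 3)) (θ : ℝ) :
    ⟪w, eR θ⟫_ℝ = w 0 * Real.cos θ + w 1 * Real.sin θ := by
  simp [eR, PiLp.inner_apply, Fin.sum_univ_three]
  ring

/-- `⟪w, e_θ(θ)⟫ = −w₀ sin θ + w₁ cos θ`. -/
theorem inner_eT (w : EuclideanSpace ℝ (Fin 3)) (θ : ℝ) :
    ⟪w, eT θ⟫_ℝ = -(w 0 * Real.sin θ) + w 1 * Real.cos θ := by
  simp [eT, PiLp.inner_apply, Fin.sum_univ_three]
  ring

/-- `‖e_r(θ)‖ = 1`. -/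
theorem norm_eR (θ : ℝ) : ‖eR θ‖ = 1 := by
  rw [EuclideanSpace.norm_eq]
  simp [eR, Fin.sum_univ_three]

/-- `‖e_θ(θ)‖ = 1`. -/
theorem norm_eT (θ : ℝ) : ‖eT θ‖ = 1 := by
  rw [EuclideanSpace.norm_eq]
  simp [eT, Fin.sum_univ_three]

/-- `e₃ = EuclideanSpace.single 2 1` (definitional). -/
theorem e3_eq : e3 = EuclideanSpace.single (2 : Fin 3) (1 : ℝ) := rfl

/-- `|⟪w, e_r⟫| ≤ ‖w‖`. -/
theorem abs_inner_eR_le (w : EuclideanSpace ℝ (Fin 3)) (θ : ℝ) : |⟪w, eR θ⟫_ℝ| ≤ ‖w‖ := by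
  simpa [norm_eR] using abs_real_inner_le_norm w (eR θ)

/-- `|⟪w, e_θ⟫| ≤ ‖w‖`. -/
theorem abs_inner_eT_le (w : EuclideanSpace ℝ (Fin 3)) (θ : ℝ) : |⟪w, eT θ⟫_ℝ| ≤ ‖w‖ := by
  simpa [norm_eT] using abs_real_inner_le_norm w (eT θ)

/-- `|⟪w, e₃⟫| ≤ ‖w‖`. -/
theorem abs_inner_e3_le (w : EuclideanSpace ℝ (Fin 3)) : |⟪w, e3⟫_ℝ| ≤ ‖w‖ := by
  have h1 : ‖e3‖ = 1 := by simp [e3]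
  simpa [h1] using abs_real_inner_le_norm w e3

/-- The radial component only sees the horizontal part: `⟪w, e_r⟫ = ⟪w − ⟪w,e₃⟫e₃, e_r⟫`. -/
theorem inner_eR_eq_inner_horizontal (w : EuclideanSpace ℝ (Fin 3)) (θ : ℝ) :
    ⟪w, eR θ⟫_ℝ = ⟪w - ⟪w, e3⟫_ℝ • e3, eR θ⟫_ℝ := by
  simp [eR, e3, PiLp.inner_apply, Fin.sum_univ_three]

/-- `|ω_r| ≤ |ω_h|`: `|⟪w, e_r⟫| ≤ ‖w − ⟪w,e₃⟫e₃‖`. -/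
theorem abs_inner_eR_le_norm_horizontal (w : EuclideanSpace ℝ (Fin 3)) (θ : ℝ) :
    |⟪w, eR θ⟫_ℝ| ≤ ‖w - ⟪w, e3⟫_ℝ • e3‖ := by
  rw [inner_eR_eq_inner_horizontal]
  exact abs_inner_eR_le _ θ

/-- The cylinder point in the standard basis. -/
theorem cylPt_eq (r θ z : ℝ) :
    cylPt r θ z = (r * Real.cos θ) • EuclideanSpace.single (0 : Fin 3) (1 : ℝ)
      + (r * Real.sin θ) • EuclideanSpace.single (1 : Fin 3) (1 : ℝ) + z • e3 := by
  ext i; fin_cases i <;> simp [cylPt, e3]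

/-- `r e_θ(θ)` in the standard basis. -/
theorem smul_eT_eq (r θ : ℝ) :
    r • eT θ = (r * -Real.sin θ) • EuclideanSpace.single (0 : Fin 3) (1 : ℝ)
      + (r * Real.cos θ) • EuclideanSpace.single (1 : Fin 3) (1 : ℝ) := by
  ext i; fin_cases i <;> simp [eT]

/-- On the axis the cylinder point is `z e₃`. -/
theorem cylPt_zero (θ z : ℝ) : cylPt 0 θ z = z • e3 := by
  ext i; fin_cases i <;> simp [cylPt, e3]

/-- `z ↦ cylPt r θ z` has derivative `e₃`. -/
theorem hasDerivAt_cylPt_z (r θ z : ℝ) : HasDerivAt (fun z' => cylPt r θ z') e3 z := by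
  have h : (fun z' => cylPt r θ z') = fun z' => cylPt r θ 0 + z' • e3 := by
    funext z'; ext i; fin_cases i <;> simp [cylPt, e3]
  rw [h]
  simpa using ((hasDerivAt_id z).smul_const e3).const_add (cylPt r θ 0)

/-- The map `(θ, s, r, z) ↦ cylPt r θ z` is smooth (any arrangement of the real parameters through
smooth coordinate maps). -/
theorem contDiff_cylPt_comp {X : Type*} [NormedAddCommGroup X] [NormedSpace ℝ X] {n : WithTop ℕ∞}
    {fr fθ fz : X → ℝ} (hr : ContDiff ℝ n fr) (hθ : ContDiff ℝ n fθ) (hz : ContDiff ℝ n fz) :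
    ContDiff ℝ n fun x => cylPt (fr x) (fθ x) (fz x) := by
  have h : (fun x => cylPt (fr x) (fθ x) (fz x)) = fun x =>
      (fr x * Real.cos (fθ x)) • EuclideanSpace.single (0 : Fin 3) (1 : ℝ)
        + (fr x * Real.sin (fθ x)) • EuclideanSpace.single (1 : Fin 3) (1 : ℝ) + fz x • e3 := by
    funext x; exact cylPt_eq _ _ _
  rw [h]
  exact ((hr.mul (Real.contDiff_cos.comp hθ)).smul contDiff_const).add
    ((hr.mul (Real.contDiff_sin.comp hθ)).smul contDiff_const) |>.add (hz.smul contDiff_const)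

/-- `θ ↦ e_θ(θ)` is smooth. -/
theorem contDiff_eT_comp {X : Type*} [NormedAddCommGroup X] [NormedSpace ℝ X] {n : WithTop ℕ∞}
    {fθ : X → ℝ} (hθ : ContDiff ℝ n fθ) : ContDiff ℝ n fun x => eT (fθ x) := by
  have h : (fun x => eT (fθ x)) = fun x =>
      (-Real.sin (fθ x)) • EuclideanSpace.single (0 : Fin 3) (1 : ℝ)
        + (Real.cos (fθ x)) • EuclideanSpace.single (1 : Fin 3) (1 : ℝ) := by
    funext x; ext i; fin_cases i <;> simp [eT]
  rw [h]
  exact ((Real.contDiff_sin.comp hθ).neg.smul contDiff_const).add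
    ((Real.contDiff_cos.comp hθ).smul contDiff_const)

/-! ### (c) the `z`-derivative of `Γ` -/

/-- Pointwise: `ω_r r = ∂_θ v₃ − r ⟪Dv e₃, e_θ⟫` along the circle, for a differentiable slice. -/
theorem inner_curl_eR_mul (u : EuclideanSpace ℝ (Fin 3) → EuclideanSpace ℝ (Fin 3)) (r θ z : ℝ) :
    ⟪curl u (cylPt r θ z), eR θ⟫_ℝ * r =
      fderiv ℝ u (cylPt r θ z) (r • eT θ) 2 - r * ⟪fderiv ℝ u (cylPt r θ z) e3, eT θ⟫_ℝ := by
  rw [inner_eR, inner_eT, smul_eT_eq, map_add, map_smul, map_smul, e3_eq]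
  simp only [curl, PiLp.add_apply, PiLp.smul_apply, smul_eq_mul]
  simp only [Fin.isValue, Matrix.cons_val_zero, Matrix.cons_val_one]
  ring


/-- Continuity of `θ ↦ cylPt r θ z`. -/
theorem continuous_cylPt_θ (r z : ℝ) : Continuous fun θ => cylPt r θ z :=
  (contDiff_cylPt_comp (n := 0) contDiff_const contDiff_id contDiff_const).continuous

/-- The derivative of a smooth slice along the vertical line through `cylPt r θ z`. -/
theorem hasDerivAt_slice_comp_cylPt_z {u : EuclideanSpace ℝ (Fin 3) → EuclideanSpace ℝ (Fin 3)}
    (hu : Differentiable ℝ u) (r θ z : ℝ) :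
    HasDerivAt (fun z' => u (cylPt r θ z')) (fderiv ℝ u (cylPt r θ z) e3) z :=
  (hu (cylPt r θ z)).hasFDerivAt.comp_hasDerivAt z (hasDerivAt_cylPt_z r θ z)

/-- The derivative of a smooth slice along the circle `θ ↦ cylPt r θ z`. -/
theorem hasDerivAt_slice_comp_cylPt_θ {u : EuclideanSpace ℝ (Fin 3) → EuclideanSpace ℝ (Fin 3)}
    (hu : Differentiable ℝ u) (r θ z : ℝ) :
    HasDerivAt (fun θ' => u (cylPt r θ' z)) (fderiv ℝ u (cylPt r θ z) (r • eT θ)) θ :=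
  (hu (cylPt r θ z)).hasFDerivAt.comp_hasDerivAt θ (hasDerivAt_cylPt_theta r θ z)

/-- `∮ ∂_θ v₃ = 0`: the integral over a period of the `θ`-derivative of the vertical component vanishes. -/
theorem integral_fderiv_tangent_apply_two {u : EuclideanSpace ℝ (Fin 3) → EuclideanSpace ℝ (Fin 3)}
    (hu : ContDiff ℝ 1 u) (r z : ℝ) :
    ∫ θ in (0 : ℝ)..(2 * Real.pi), fderiv ℝ u (cylPt r θ z) (r • eT θ) 2 = 0 := by
  have hd : Differentiable ℝ u := hu.differentiable one_ne_zero
  -- `θ ↦ v₃(cylPt r θ z) = ⟪u (cylPt r θ z), e₃⟫` and its derivative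
  have hderiv : ∀ θ : ℝ, HasDerivAt (fun θ' => ⟪u (cylPt r θ' z), e3⟫_ℝ)
      (fderiv ℝ u (cylPt r θ z) (r • eT θ) 2) θ := by
    intro θ
    have h := (hasDerivAt_slice_comp_cylPt_θ hd r θ z).inner ℝ (hasDerivAt_const θ e3)
    simpa [inner_e3] using h
  have hcont : Continuous fun θ => fderiv ℝ u (cylPt r θ z) (r • eT θ) 2 := by
    have hD : Continuous (fderiv ℝ u) := hu.continuous_fderiv one_ne_zero
    have h1 : Continuous fun θ => fderiv ℝ u (cylPt r θ z) (r • eT θ) :=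
      (hD.comp (continuous_cylPt_θ r z)).clm_apply (continuous_eT.const_smul r)
    exact (EuclideanSpace.proj (2 : Fin 3) : EuclideanSpace ℝ (Fin 3) →L[ℝ] ℝ).continuous.comp h1
  rw [integral_eq_sub_of_hasDerivAt (fun θ _ => hderiv θ) (hcont.intervalIntegrable _ _),
    cylPt_two_pi, sub_self]

/-! ### (d) the shell inequalities -/

/-- Pointwise bound of the circle-term integrand under the sign `ω₃ ≥ 0`:
`|(v_r ω₃ − ω_r v₃) r| ≤ (B ω₃ + B |ω_h|) r` when `|v| ≤ B`, `r ≥ 0`. -/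
theorem abs_circleTerm_integrand_le (w q : EuclideanSpace ℝ (Fin 3)) {θ r B : ℝ} (hr : 0 ≤ r)
    (hw : ‖w‖ ≤ B) (hq : 0 ≤ ⟪q, e3⟫_ℝ) :
    |(⟪w, eR θ⟫_ℝ * ⟪q, e3⟫_ℝ - ⟪q, eR θ⟫_ℝ * ⟪w, e3⟫_ℝ) * r| ≤
      B * (⟪q, e3⟫_ℝ * r + ‖q - ⟪q, e3⟫_ℝ • e3‖ * r) := by
  have h1 : |⟪w, eR θ⟫_ℝ| ≤ B := (abs_inner_eR_le w θ).trans hw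
  have h2 : |⟪w, e3⟫_ℝ| ≤ B := (abs_inner_e3_le w).trans hw
  have h3 : |⟪q, eR θ⟫_ℝ| ≤ ‖q - ⟪q, e3⟫_ℝ • e3‖ := abs_inner_eR_le_norm_horizontal q θ
  have hB : 0 ≤ B := (norm_nonneg w).trans hw
  rw [abs_mul, abs_of_nonneg hr]
  have h4 : |⟪w, eR θ⟫_ℝ * ⟪q, e3⟫_ℝ - ⟪q, eR θ⟫_ℝ * ⟪w, e3⟫_ℝ| ≤
      B * ⟪q, e3⟫_ℝ + ‖q - ⟪q, e3⟫_ℝ • e3‖ * B := by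
    refine (abs_sub _ _).trans ?_
    rw [abs_mul, abs_mul, abs_of_nonneg hq]
    have h5 : |⟪q, eR θ⟫_ℝ| * |⟪w, e3⟫_ℝ| ≤ ‖q - ⟪q, e3⟫_ℝ • e3‖ * B :=
      mul_le_mul h3 h2 (abs_nonneg _) (norm_nonneg _)
    have h6 : |⟪w, eR θ⟫_ℝ| * ⟪q, e3⟫_ℝ ≤ B * ⟪q, e3⟫_ℝ := mul_le_mul_of_nonneg_right h1 hq
    linarith
  calc |⟪w, eR θ⟫_ℝ * ⟪q, e3⟫_ℝ - ⟪q, eR θ⟫_ℝ * ⟪w, e3⟫_ℝ| * r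
      ≤ (B * ⟪q, e3⟫_ℝ + ‖q - ⟪q, e3⟫_ℝ • e3‖ * B) * r := mul_le_mul_of_nonneg_right h4 hr
    _ = B * (⟪q, e3⟫_ℝ * r + ‖q - ⟪q, e3⟫_ℝ • e3‖ * r) := by ring

/-- The horizontal projection `q ↦ q − ⟪q, e₃⟫ e₃` is continuous (it is linear). -/
theorem continuous_horizontal :
    Continuous fun q : EuclideanSpace ℝ (Fin 3) => q - ⟪q, e3⟫_ℝ • e3 := by
  have h1 : Continuous fun q : EuclideanSpace ℝ (Fin 3) => ⟪q, e3⟫_ℝ := continuous_id.inner continuous_const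
  exact continuous_id.sub (h1.smul continuous_const)

/-- Integral bookkeeping for the shell inequality: if `|f| ≤ B (g₁ + g₂)` pointwise with all three continuous, then
`|∫₀^{2π} f| ≤ B (∫₀^{2π} g₁ + ∫₀^{2π} g₂)`. -/
theorem abs_integral_le_const_mul_add {f g₁ g₂ : ℝ → ℝ} (hf : Continuous f) (hg₁ : Continuous g₁)
    (hg₂ : Continuous g₂) {B : ℝ} (hle : ∀ θ, |f θ| ≤ B * (g₁ θ + g₂ θ)) :
    |∫ θ in (0 : ℝ)..(2 * Real.pi), f θ| ≤
      B * ((∫ θ in (0 : ℝ)..(2 * Real.pi), g₁ θ) + ∫ θ in (0 : ℝ)..(2 * Real.pi), g₂ θ) := by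
  have h2π : (0 : ℝ) ≤ 2 * Real.pi := by positivity
  have i1 : |∫ θ in (0 : ℝ)..(2 * Real.pi), f θ| ≤ ∫ θ in (0 : ℝ)..(2 * Real.pi), |f θ| :=
    intervalIntegral.abs_integral_le_integral_abs h2π
  have i2 : (∫ θ in (0 : ℝ)..(2 * Real.pi), |f θ|) ≤ ∫ θ in (0 : ℝ)..(2 * Real.pi), B * (g₁ θ + g₂ θ) :=
    intervalIntegral.integral_mono_on h2π (hf.abs.intervalIntegrable _ _)
      ((continuous_const.mul (hg₁.add hg₂)).intervalIntegrable _ _) fun θ _ => hle θ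
  have i3 : (∫ θ in (0 : ℝ)..(2 * Real.pi), B * (g₁ θ + g₂ θ)) =
      B * ((∫ θ in (0 : ℝ)..(2 * Real.pi), g₁ θ) + ∫ θ in (0 : ℝ)..(2 * Real.pi), g₂ θ) := by
    rw [intervalIntegral.integral_const_mul,
      intervalIntegral.integral_add (hg₁.intervalIntegrable _ _) (hg₂.intervalIntegrable _ _)]
  exact i1.trans (i2.trans i3.le)

end Summit.NavierStokesRegularity.NavierStokesRegularity.Theorems.AxisTwistDoorAveragedConeLiouvilleCylFrame

end
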